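import Literature.NumberTheory.EllipticCurves.PAdicMeasureWeightKAction
import Literature.NumberTheory.EllipticCurves.PAdicDistributionModule
import HarnessLib

/-!
# The weight-`k` action of `Σ₀(p)` on measures on `ℤ_p`: action law and the moment form

Sequel to `PAdicMeasureWeightKAction` (Bellaïche 2011, §3.1–3.2; Pollack–Stevens 2011, §3).  For
`γ = (a b; c d) ∈ Σ₀(p)` (`‖a‖ = 1`, `‖c‖ < 1`) the Möbius maps `m_γ(z) = (b + dz)(a + cz)^{-1}`
compose contravariantly and the automorphy factors multiply:

  `m_{γ₁γ₂} = m_{γ₂} ∘ m_{γ₁}`,   `A + C z = (a₁ + c₁ z)(a₂ + c₂ m_{γ₁}(z))`   (`moebius_mul`, `aut_mul`)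

(so `f ↦ (a + cz)^k f(m_γ z)` is a LEFT action of `Σ₀(p)` on functions and its dual a RIGHT action on
measures).  Consequences proved here:

* the level data of `μ |_k γ` (`weightAct_μ`: `(μ|_kγ)_n(s) = ∫ 1_s(m_γ z)(a + cz)^k dμ`), whence the
  action on the MODULE `𝔻(ℤ_p)` of bounded distributions as a linear map `weightActD k γ : 𝔻 →ₗ 𝔻`
  (`PAdicDistributionModule.distributions`) and **the action law**
  `weightActD k (γ₁γ₂) = weightActD k γ₂ ∘ weightActD k γ₁` (`weightActD_mul`), `weightActD k 1 = id`;
* **the moment form** `formOf k μ ∈ 𝕜^{k+1}`, the coefficients of `w ↦ ∫ (w₀ + w₁ z)^k dμ(z)`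
  (`i ↦ C(k,i) ∫ zⁱ dμ`), and its **equivariance** `formOf k (μ |_k γ) = Symᵏ(γ) · formOf k μ`
  (`formOf_weightAct`, with the `symPow`/`evalVec` of `HidaOrdinaryCohomologySymPow`: since
  `(a + cz)(w₀ + w₁ m_γ z) = (a w₀ + b w₁) + (c w₀ + d w₁) z`, the form of `μ|_kγ` is `w ↦ F_μ(γ w)`) —
  Bellaïche's specialisation `ρ_k^* : 𝔻_k → V_k` (§3.2.3) in the coordinates of the tree's `act k γ`.

Brick B3b of the bottom-up plan recorded with the named fact
`greenbergStevens_kitagawa_twoVariable_interpolation_allBranches`.  Everything is proved; no named facts.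

## References

* J. Bellaïche, *Critical `p`-adic `L`-functions*, Invent. Math. 189 (2012), §3.1–3.2. [Bellaiche2011]
* R. Pollack, G. Stevens, Ann. Sci. ÉNS 44 (2011), §3. [PollackStevens2011]
-/

noncomputable section

open Filter Topology Matrix

namespace Literature.NumberTheory.EllipticCurves

variable {p : ℕ} [Fact p.Prime]

/-! ### Algebra of the Möbius maps -/

section MoebiusAlgebra

/-- **Characterisation of `m_γ z`**: the unique `w` with `(a + cz) w = b + dz`. [folklore] -/
theorem moebius_eq_of_mul_eq {a c : ℤ_[p]} (ha : ‖a‖ = 1) (hc : ‖c‖ < 1) {b d z w : ℤ_[p]}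
    (h : (a + c * z) * w = b + d * z) : moebius ha hc b d z = w := by
  have hu : IsUnit (a + c * z) := PadicInt.isUnit_iff.mpr (norm_add_mul_eq_one ha hc z)
  exact hu.mul_left_cancel ((autFactor_mul_moebius ha hc b d z).trans h.symm)

/-- **The automorphy factors multiply**: `A + C z = (a₁ + c₁ z)(a₂ + c₂ m_{γ₁} z)` for
`γ₁γ₂ = (A B; C D)`. [folklore] -/
theorem aut_mul {a₁ c₁ : ℤ_[p]} (ha₁ : ‖a₁‖ = 1) (hc₁ : ‖c₁‖ < 1) (b₁ d₁ a₂ c₂ z : ℤ_[p]) :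
    (a₁ * a₂ + b₁ * c₂) + (c₁ * a₂ + d₁ * c₂) * z =
      (a₁ + c₁ * z) * (a₂ + c₂ * moebius ha₁ hc₁ b₁ d₁ z) := by
  have h := autFactor_mul_moebius ha₁ hc₁ b₁ d₁ z
  calc (a₁ * a₂ + b₁ * c₂) + (c₁ * a₂ + d₁ * c₂) * z
      = a₂ * (a₁ + c₁ * z) + c₂ * (b₁ + d₁ * z) := by ring
    _ = a₂ * (a₁ + c₁ * z) + c₂ * ((a₁ + c₁ * z) * moebius ha₁ hc₁ b₁ d₁ z) := by rw [h]
    _ = (a₁ + c₁ * z) * (a₂ + c₂ * moebius ha₁ hc₁ b₁ d₁ z) := by ring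

/-- **The Möbius maps compose contravariantly**: `m_{γ₁γ₂} = m_{γ₂} ∘ m_{γ₁}`. [folklore] -/
theorem moebius_mul {a₁ c₁ a₂ c₂ : ℤ_[p]} (ha₁ : ‖a₁‖ = 1) (hc₁ : ‖c₁‖ < 1) (ha₂ : ‖a₂‖ = 1)
    (hc₂ : ‖c₂‖ < 1) (b₁ d₁ b₂ d₂ : ℤ_[p]) (hA : ‖a₁ * a₂ + b₁ * c₂‖ = 1) (hC : ‖c₁ * a₂ + d₁ * c₂‖ < 1)
    (z : ℤ_[p]) :
    moebius hA hC (a₁ * b₂ + b₁ * d₂) (c₁ * b₂ + d₁ * d₂) z =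
      moebius ha₂ hc₂ b₂ d₂ (moebius ha₁ hc₁ b₁ d₁ z) := by
  apply moebius_eq_of_mul_eq
  have h1 := autFactor_mul_moebius ha₁ hc₁ b₁ d₁ z
  have h2 := autFactor_mul_moebius ha₂ hc₂ b₂ d₂ (moebius ha₁ hc₁ b₁ d₁ z)
  rw [aut_mul ha₁ hc₁ b₁ d₁ a₂ c₂ z, mul_assoc, h2]
  calc (a₁ + c₁ * z) * (b₂ + d₂ * moebius ha₁ hc₁ b₁ d₁ z)
      = b₂ * (a₁ + c₁ * z) + d₂ * ((a₁ + c₁ * z) * moebius ha₁ hc₁ b₁ d₁ z) := by ring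
    _ = b₂ * (a₁ + c₁ * z) + d₂ * (b₁ + d₁ * z) := by rw [h1]
    _ = (a₁ * b₂ + b₁ * d₂) + (c₁ * b₂ + d₁ * d₂) * z := by ring

/-- The identity matrix: `m_1 z = z`. [folklore] -/
theorem moebius_one (h1 : ‖(1 : ℤ_[p])‖ = 1) (h0 : ‖(0 : ℤ_[p])‖ < 1) (z : ℤ_[p]) :
    moebius h1 h0 0 1 z = z :=
  moebius_eq_of_mul_eq h1 h0 (by ring)

end MoebiusAlgebra

/-! ### Level data of the weight-`k` action; the action on the module `𝔻(ℤ_p)` -/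

namespace BoundedDistribution

variable {𝕜 : Type*} [NormedField 𝕜] [NormedAlgebra ℚ_[p] 𝕜] [IsUltrametricDist 𝕜] [CompleteSpace 𝕜]
  (D : BoundedDistribution (ProfiniteTower.padicInt p) 𝕜)

/-- **The level data of `μ |_k γ`**: `(μ|_kγ)_n(s) = ∫ 1_s(m_γ z) (a + cz)^k dμ(z)`. [folklore] -/
theorem weightAct_μ (k : ℕ) {a c : ℤ_[p]} (ha : ‖a‖ = 1) (hc : ‖c‖ < 1) (b d : ℤ_[p]) (n : ℕ)
    (s : ZMod (p ^ n)) :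
    (D.weightAct k ha hc b d).μ n s =
      D.integral fun z => cellInd n s (moebius ha hc b d z) * autPow k a c z := by
  classical
  have huc : ∀ t : ZMod (p ^ n), UniformContinuous fun z => cellInd (𝕜 := 𝕜) n t z * autPow k a c z :=
    fun t => uniformContinuous_mul' (uniformContinuous_cellInd _ _) (uniformContinuous_autPow k a c)
  rw [weightAct, map_μ]
  simp only [mulFn_μ]
  change (∑ t ∈ Finset.univ.filter (fun t : ZMod (p ^ n) =>
      (ProfiniteTower.moebiusCellMap p ha hc b d).map n t = s),
      D.integral fun z => cellInd n t z * autPow k a c z) = _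
  rw [← D.integral_finset_sum _ fun t _ => huc t]
  refine congr_arg D.integral (funext fun z => ?_)
  rw [← Finset.sum_mul]
  congr 1
  -- `Σ_{t ↦ s} 1_t(z) = 1_s(m_γ z)`
  simp only [cellInd_apply]
  rw [Finset.sum_ite_eq]
  simp only [Finset.mem_filter, Finset.mem_univ, true_and]
  have h := proj_moebius ha hc b d n z
  simp only [ProfiniteTower.padicInt_proj] at h
  rw [h]
  exact ite_congr rfl (fun _ => rfl) (fun _ => rfl)

/-- The level data of `μ |_k γ` depend only (and linearly) on those of `μ`: formula through
`integralFn`. [folklore] -/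
theorem weightAct_μ_eq_integralFn (k : ℕ) {a c : ℤ_[p]} (ha : ‖a‖ = 1) (hc : ‖c‖ < 1) (b d : ℤ_[p])
    (n : ℕ) (s : ZMod (p ^ n)) :
    (D.weightAct k ha hc b d).μ n s = (ProfiniteTower.padicInt p).integralFn D.μ
      fun z => cellInd n s (moebius ha hc b d z) * autPow k a c z := by
  rw [weightAct_μ, integral_eq_integralFn]

omit [NormedAlgebra ℚ_[p] 𝕜] [CompleteSpace 𝕜] in
/-- **The integral of a cell indicator is the level datum**: `∫ 1_{s + p^n} dμ = μ_n(s)`. [folklore] -/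
theorem integral_cellInd (n : ℕ) (s : ZMod (p ^ n)) : D.integral (cellInd n s) = D.μ n s := by
  classical
  have hfg : ∀ z : ℤ_[p], cellInd (𝕜 := 𝕜) n s z =
      (fun t : ZMod (p ^ n) => if t = s then (1 : 𝕜) else 0) ((ProfiniteTower.padicInt p).proj n z) :=
    fun z => ite_congr rfl (fun _ => rfl) (fun _ => rfl)
  rw [D.integral_eq_sum_of_factorsThrough (m := n) (fun t : ZMod (p ^ n) => if t = s then (1 : 𝕜) else 0) hfg]
  simp only [mul_ite, mul_one, mul_zero]
  change (∑ x : ZMod (p ^ n), if x = s then D.μ n x else 0) = D.μ n s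
  rw [Finset.sum_ite_eq' Finset.univ s (D.μ n), if_pos (Finset.mem_univ _)]

end BoundedDistribution

section Module

variable {𝕜 : Type*} [NormedField 𝕜] [NormedAlgebra ℚ_[p] 𝕜] [IsUltrametricDist 𝕜] [CompleteSpace 𝕜]

omit [IsUltrametricDist 𝕜] [CompleteSpace 𝕜] in
/-- The integrand of the level data is uniformly continuous. [folklore] -/
theorem uniformContinuous_cellInd_moebius_mul_autPow (k : ℕ) {a c : ℤ_[p]} (ha : ‖a‖ = 1)
    (hc : ‖c‖ < 1) (b d : ℤ_[p]) (n : ℕ) (s : ZMod (p ^ n)) :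
    UniformContinuous fun z => cellInd (𝕜 := 𝕜) n s (moebius ha hc b d z) * BoundedDistribution.autPow k a c z :=
  BoundedDistribution.uniformContinuous_mul'
    ((uniformContinuous_cellInd n s).comp (uniformContinuous_moebius ha hc b d))
    (BoundedDistribution.uniformContinuous_autPow k a c)

variable (p 𝕜) in
/-- **The weight-`k` action of `γ ∈ Σ₀(p)` on the module `𝔻(ℤ_p)` of bounded distributions**, a
`𝕜`-linear map (Bellaïche 2011, §3.1, dual action on `𝔻`). [cite: Bellaiche2011, §3.1] -/
def weightActD (k : ℕ) {a c : ℤ_[p]} (ha : ‖a‖ = 1) (hc : ‖c‖ < 1) (b d : ℤ_[p]) :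
    (ProfiniteTower.padicInt p).distributions 𝕜 →ₗ[𝕜] (ProfiniteTower.padicInt p).distributions 𝕜 where
  toFun μ := ⟨((ProfiniteTower.toBounded μ.2).weightAct k ha hc b d).μ,
    ((ProfiniteTower.toBounded μ.2).weightAct k ha hc b d).μ_mem⟩
  map_add' μ ν := by
    apply Subtype.ext
    funext n s
    simp only [Submodule.coe_add, Pi.add_apply, BoundedDistribution.weightAct_μ_eq_integralFn,
      ProfiniteTower.toBounded_μ]
    exact ProfiniteTower.integralFn_add μ.2 ν.2 (uniformContinuous_cellInd_moebius_mul_autPow k ha hc b d n s)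
  map_smul' r μ := by
    apply Subtype.ext
    funext n s
    simp only [Submodule.coe_smul, Pi.smul_apply, smul_eq_mul, RingHom.id_apply,
      BoundedDistribution.weightAct_μ_eq_integralFn, ProfiniteTower.toBounded_μ]
    exact ProfiniteTower.integralFn_smul r μ.2 (uniformContinuous_cellInd_moebius_mul_autPow k ha hc b d n s)

/-- The level data of `weightActD k γ μ`. [folklore] -/
theorem weightActD_apply (k : ℕ) {a c : ℤ_[p]} (ha : ‖a‖ = 1) (hc : ‖c‖ < 1) (b d : ℤ_[p])
    (μ : (ProfiniteTower.padicInt p).distributions 𝕜) (n : ℕ) (s : ZMod (p ^ n)) :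
    (weightActD p 𝕜 k ha hc b d μ).1 n s =
      (ProfiniteTower.padicInt p).integralFn μ.1
        fun z => cellInd n s (moebius ha hc b d z) * BoundedDistribution.autPow k a c z :=
  (ProfiniteTower.toBounded μ.2).weightAct_μ_eq_integralFn k ha hc b d n s

/-- **Integration against `weightActD k γ μ`**: `∫ f d(μ|_kγ) = ∫ f(m_γ z)(a + cz)^k dμ`. [folklore] -/
theorem integralFn_weightActD (k : ℕ) {a c : ℤ_[p]} (ha : ‖a‖ = 1) (hc : ‖c‖ < 1) (b d : ℤ_[p])
    (μ : (ProfiniteTower.padicInt p).distributions 𝕜) {f : ℤ_[p] → 𝕜} (hf : UniformContinuous f) :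
    (ProfiniteTower.padicInt p).integralFn (weightActD p 𝕜 k ha hc b d μ).1 f =
      (ProfiniteTower.padicInt p).integralFn μ.1
        fun z => f (moebius ha hc b d z) * BoundedDistribution.autPow k a c z := by
  have h := (ProfiniteTower.toBounded μ.2).integral_weightAct k ha hc b d hf
  rw [BoundedDistribution.integral_eq_integralFn, BoundedDistribution.integral_eq_integralFn] at h
  exact h

/-- **The action law on `𝔻(ℤ_p)`**: `μ |_k (γ₁γ₂) = (μ |_k γ₁) |_k γ₂` — a right action of `Σ₀(p)`
(Bellaïche 2011, §3.1). [cite: Bellaiche2011, §3.1] -/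
theorem weightActD_mul (k : ℕ) {a₁ c₁ a₂ c₂ : ℤ_[p]} (ha₁ : ‖a₁‖ = 1) (hc₁ : ‖c₁‖ < 1) (ha₂ : ‖a₂‖ = 1)
    (hc₂ : ‖c₂‖ < 1) (b₁ d₁ b₂ d₂ : ℤ_[p]) (hA : ‖a₁ * a₂ + b₁ * c₂‖ = 1) (hC : ‖c₁ * a₂ + d₁ * c₂‖ < 1) :
    weightActD p 𝕜 k hA hC (a₁ * b₂ + b₁ * d₂) (c₁ * b₂ + d₁ * d₂) =
      (weightActD p 𝕜 k ha₂ hc₂ b₂ d₂).comp (weightActD p 𝕜 k ha₁ hc₁ b₁ d₁) := by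
  refine LinearMap.ext fun μ => Subtype.ext (funext fun n => funext fun s => ?_)
  rw [LinearMap.comp_apply, weightActD_apply, weightActD_apply,
    integralFn_weightActD k ha₁ hc₁ b₁ d₁ μ (uniformContinuous_cellInd_moebius_mul_autPow k ha₂ hc₂ b₂ d₂ n s)]
  refine congr_arg ((ProfiniteTower.padicInt p).integralFn μ.1) (funext fun z => ?_)
  rw [moebius_mul ha₁ hc₁ ha₂ hc₂ b₁ d₁ b₂ d₂ hA hC z, mul_assoc]
  congr 1
  -- the automorphy factors multiply
  rw [BoundedDistribution.autPow_apply, BoundedDistribution.autPow_apply, BoundedDistribution.autPow_apply,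
    ← map_mul, ← PadicInt.coe_mul, ← mul_pow, mul_comm (a₂ + _), ← aut_mul ha₁ hc₁ b₁ d₁ a₂ c₂ z]

/-- **The identity acts trivially on `𝔻(ℤ_p)`.** [folklore] -/
theorem weightActD_one (k : ℕ) (h1 : ‖(1 : ℤ_[p])‖ = 1) (h0 : ‖(0 : ℤ_[p])‖ < 1) :
    weightActD p 𝕜 k h1 h0 0 1 = LinearMap.id := by
  refine LinearMap.ext fun μ => Subtype.ext (funext fun n => funext fun s => ?_)
  rw [weightActD_apply, LinearMap.id_apply]
  have hint : (ProfiniteTower.padicInt p).integralFn μ.1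
      (fun z => cellInd n s (moebius h1 h0 0 1 z) * BoundedDistribution.autPow (𝕜 := 𝕜) k 1 0 z) =
      (ProfiniteTower.toBounded μ.2).integral (cellInd n s) := by
    rw [BoundedDistribution.integral_eq_integralFn, ProfiniteTower.toBounded_μ]
    refine congr_arg ((ProfiniteTower.padicInt p).integralFn μ.1) (funext fun z => ?_)
    rw [moebius_one, BoundedDistribution.autPow_apply, zero_mul, add_zero, one_pow, PadicInt.coe_one,
      map_one, mul_one]
  rw [hint, BoundedDistribution.integral_cellInd, ProfiniteTower.toBounded_μ]

end Module

/-! ### The moment form and its equivariance -/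

namespace BoundedDistribution

variable {𝕜 : Type*} [NormedField 𝕜] [NormedAlgebra ℚ_[p] 𝕜] [IsUltrametricDist 𝕜] [CompleteSpace 𝕜]
  (D : BoundedDistribution (ProfiniteTower.padicInt p) 𝕜)

/-- The pairing power `z ↦ (w₀ + w₁ z)^k`. [folklore] -/
def linPow (k : ℕ) (w : Fin 2 → 𝕜) (z : ℤ_[p]) : 𝕜 := (w 0 + w 1 * algebraMap ℚ_[p] 𝕜 (z : ℚ_[p])) ^ k

omit [IsUltrametricDist 𝕜] [CompleteSpace 𝕜] in
/-- Unfolding lemma for `linPow`. [folklore] -/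
theorem linPow_apply (k : ℕ) (w : Fin 2 → 𝕜) (z : ℤ_[p]) :
    linPow k w z = (w 0 + w 1 * algebraMap ℚ_[p] 𝕜 (z : ℚ_[p])) ^ k := rfl

omit [IsUltrametricDist 𝕜] [CompleteSpace 𝕜] in
/-- `linPow` is uniformly continuous. [folklore] -/
theorem uniformContinuous_linPow (k : ℕ) (w : Fin 2 → 𝕜) : UniformContinuous (linPow k w : ℤ_[p] → 𝕜) :=
  CompactSpace.uniformContinuous_of_continuous (by unfold linPow; fun_prop)

/-- **The moment form** of a bounded distribution on `ℤ_p` in weight `k`: the coefficient vector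
`i ↦ C(k,i) ∫ zⁱ dμ` of the binary form `w ↦ ∫ (w₀ + w₁ z)^k dμ(z)` (Bellaïche's specialisation
`ρ_k^* : 𝔻 → V_k`, §3.2.3, in the coordinates `evalVec` of `HidaOrdinaryCohomologySymPow`).
[cite: Bellaiche2011, §3.2.3] -/
def formOf (k : ℕ) : Fin (k + 1) → 𝕜 := fun i =>
  (k.choose i : 𝕜) * D.integral fun z => algebraMap ℚ_[p] 𝕜 (z : ℚ_[p]) ^ (i : ℕ)

omit [IsUltrametricDist 𝕜] [CompleteSpace 𝕜] in
/-- Unfolding lemma for `formOf`. [folklore] -/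
theorem formOf_apply (k : ℕ) (i : Fin (k + 1)) :
    D.formOf k i = (k.choose i : 𝕜) * D.integral fun z => algebraMap ℚ_[p] 𝕜 (z : ℚ_[p]) ^ (i : ℕ) := rfl

/-- **The moment form is the form `w ↦ ∫ (w₀ + w₁ z)^k dμ`.** [folklore] -/
theorem evalVec_formOf (k : ℕ) (w : Fin 2 → 𝕜) :
    ModularForms.HidaCohomology.evalVec k (D.formOf k) w = D.integral (linPow k w) := by
  set g : ℕ → (ℤ_[p] → 𝕜) := fun m z =>
    (w 1 * algebraMap ℚ_[p] 𝕜 (z : ℚ_[p])) ^ m * (w 0) ^ (k - m) * (k.choose m : 𝕜) with hg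
  have hterm : ∀ m : ℕ, UniformContinuous (g m) := fun m =>
    CompactSpace.uniformContinuous_of_continuous (by simp only [hg]; fun_prop)
  have hexp : (linPow k w : ℤ_[p] → 𝕜) = fun z => ∑ m ∈ Finset.range (k + 1), g m z := by
    funext z
    rw [linPow_apply, add_comm, add_pow]
  rw [hexp, D.integral_finset_sum _ fun m _ => hterm m, ModularForms.HidaCohomology.evalVec]
  have hcoef : ∀ i : Fin (k + 1),
      D.formOf k i * w 0 ^ (k - (i : ℕ)) * w 1 ^ (i : ℕ) = D.integral (g i) := by
    intro i
    have h0 : UniformContinuous fun z : ℤ_[p] => algebraMap ℚ_[p] 𝕜 (z : ℚ_[p]) ^ (i : ℕ) :=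
      CompactSpace.uniformContinuous_of_continuous (by fun_prop)
    have h1 : UniformContinuous fun z : ℤ_[p] => (k.choose i : 𝕜) * algebraMap ℚ_[p] 𝕜 (z : ℚ_[p]) ^ (i : ℕ) :=
      CompactSpace.uniformContinuous_of_continuous (by fun_prop)
    have h2 : UniformContinuous fun z : ℤ_[p] =>
        (k.choose i : 𝕜) * algebraMap ℚ_[p] 𝕜 (z : ℚ_[p]) ^ (i : ℕ) * w 0 ^ (k - (i : ℕ)) :=
      CompactSpace.uniformContinuous_of_continuous (by fun_prop)
    rw [formOf_apply, ← D.integral_const_mul _ h0, ← D.integral_mul_const _ h1, ← D.integral_mul_const _ h2]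
    refine congr_arg D.integral (funext fun z => ?_)
    simp only [hg, mul_pow]
    ring
  rw [Finset.sum_congr rfl fun i _ => hcoef i]
  exact Fin.sum_univ_eq_sum_range (fun m => D.integral (g m)) (k + 1)

/-- The matrix of `γ` over `𝕜`. [folklore] -/
def matK (a b c d : ℤ_[p]) : Matrix (Fin 2) (Fin 2) 𝕜 :=
  !![algebraMap ℚ_[p] 𝕜 (a : ℚ_[p]), algebraMap ℚ_[p] 𝕜 (b : ℚ_[p]);
    algebraMap ℚ_[p] 𝕜 (c : ℚ_[p]), algebraMap ℚ_[p] 𝕜 (d : ℚ_[p])]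

omit [IsUltrametricDist 𝕜] [CompleteSpace 𝕜] in
/-- **`(a + cz)(w₀ + w₁ m_γ z) = (a w₀ + b w₁) + (c w₀ + d w₁) z`**: the pairing power transforms by
`γ` acting on the column vector `w`. [folklore] -/
theorem linPow_moebius_mul_autPow (k : ℕ) {a c : ℤ_[p]} (ha : ‖a‖ = 1) (hc : ‖c‖ < 1) (b d : ℤ_[p])
    (w : Fin 2 → 𝕜) (z : ℤ_[p]) :
    linPow k w (moebius ha hc b d z) * autPow k a c z = linPow k (matK a b c d *ᵥ w) z := by
  have h := autFactor_mul_moebius ha hc b d z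
  have h0 : (matK (𝕜 := 𝕜) a b c d *ᵥ w) 0 = algebraMap ℚ_[p] 𝕜 (a : ℚ_[p]) * w 0 + algebraMap ℚ_[p] 𝕜 (b : ℚ_[p]) * w 1 := by
    simp [matK, Matrix.mulVec, dotProduct, Fin.sum_univ_two]
  have h1 : (matK (𝕜 := 𝕜) a b c d *ᵥ w) 1 = algebraMap ℚ_[p] 𝕜 (c : ℚ_[p]) * w 0 + algebraMap ℚ_[p] 𝕜 (d : ℚ_[p]) * w 1 := by
    simp [matK, Matrix.mulVec, dotProduct, Fin.sum_univ_two]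
  -- an identity of elements of `𝕜` coming from `(a + cz) m = b + dz` in `ℤ_p`
  have hq : ((a : ℚ_[p]) + (c : ℚ_[p]) * (z : ℚ_[p])) * ((moebius ha hc b d z : ℤ_[p]) : ℚ_[p]) =
      (b : ℚ_[p]) + (d : ℚ_[p]) * (z : ℚ_[p]) := by
    have h' := congr_arg (fun x : ℤ_[p] => (x : ℚ_[p])) h
    push_cast at h'
    exact h'
  have hk := congr_arg (algebraMap ℚ_[p] 𝕜) hq
  simp only [map_mul, map_add] at hk
  have hcoe : algebraMap ℚ_[p] 𝕜 (((a + c * z) ^ k : ℤ_[p]) : ℚ_[p]) =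
      (algebraMap ℚ_[p] 𝕜 (a : ℚ_[p]) + algebraMap ℚ_[p] 𝕜 (c : ℚ_[p]) * algebraMap ℚ_[p] 𝕜 (z : ℚ_[p])) ^ k := by
    rw [PadicInt.coe_pow, PadicInt.coe_add, PadicInt.coe_mul, map_pow, map_add, map_mul]
  rw [linPow_apply, linPow_apply, autPow_apply, h0, h1, hcoe, ← mul_pow]
  congr 1
  linear_combination (w 1) * hk

/-- **Equivariance of the moment form, functional form**:
`evalVec k (formOf k (μ|_kγ)) w = evalVec k (formOf k μ) (γ w)`. [cite: Bellaiche2011, §3.2.3] -/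
theorem evalVec_formOf_weightAct (k : ℕ) {a c : ℤ_[p]} (ha : ‖a‖ = 1) (hc : ‖c‖ < 1) (b d : ℤ_[p])
    (w : Fin 2 → 𝕜) :
    ModularForms.HidaCohomology.evalVec k ((D.weightAct k ha hc b d).formOf k) w =
      ModularForms.HidaCohomology.evalVec k (D.formOf k) (matK a b c d *ᵥ w) := by
  rw [evalVec_formOf, evalVec_formOf, D.integral_weightAct k ha hc b d (uniformContinuous_linPow k w)]
  exact congr_arg D.integral (funext fun z => linPow_moebius_mul_autPow k ha hc b d w z)

end BoundedDistribution

end Literature.NumberTheory.EllipticCurves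

end
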